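import Mathlib
import Summits.ValiantsHypothesis.ValiantsHypothesis.Theorems.FifoMatchingNNNotVPSupportFnMatchings
import Summits.ValiantsHypothesis.ValiantsHypothesis.Theorems.FifoMatchingNNNotVPSupportFnCore
import Summits.ValiantsHypothesis.ValiantsHypothesis.Theorems.FifoMatchingNNDivisionHardAvoidedMatching
import Literature.Computability.AlgebraicComplexity.NestFreeMatchingPoly
import HarnessLib

/-!
# Route FifoMatching — crux `NNDivisionHard` (stmt-ValiantsHypothesis-21181):
# CALIBRATION — the noncrossing powers `NC_n^D` are UNDOMINATED (the domination rungs cannot reach them)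

The residual enemy class of record for 21181 (`GrandResidual.nnDivisionHard_iff_grandResidual`, ✓ p823791)
requires a surviving cofactor to be UNDOMINATED for every polylogarithmic set `T` of freed arcs; by
`AvoidedMatching.undominated_iff_exists_avoided_nfpm` (✓ p824440) this means: some nest-free perfect
matching carries no monomial of `h|_{T:=1}`.  This route-independent file CERTIFIES that conjunct for the
simplest candidate member named in the census, the powers of the noncrossing (LIFO) matching polynomial
`NC_n = noncrossingMatchingPoly n ℝ≥0`:

* `exists_pairwiseCrossing_nfpm` — the ALL-CROSSING matching `i ↦ i ± n` of `[2n]` is a nest-free perfect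
  matching all of whose arcs pairwise cross;
* `card_le_of_noncrossing_sub` — a noncrossing perfect matching whose arcs lie in `T ∪ arcs M`, `M`
  pairwise crossing, uses at most ONE arc of `M`, hence `n ≤ |T| + 1`;
* `exists_nfpm_avoided_by_noncrossing` — so for `|T| + 2 ≤ n` the all-crossing matching is AVOIDED by
  `NC_n` modulo `T`;
* ★ `noncrossingPow_undominated` — for `|T| + 2 ≤ n` and every `D`, `NC_n^(D+1)` (more generally every `h`
  whose shadow implies that of `NC_n`: `undominated_of_shadow_le_noncrossing`) is UNDOMINATED modulo `T`:
  `∃ A, SuppFn (NN_n|_{T:=1}) A ∧ ¬ SuppFn (NC_n^(D+1)|_{T:=1}) A`.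

Consequence (honest calibration of g5's own rungs): the Boolean-shadow domination rungs (✓ p823553,
p823637, p824095, p824360) can never decide the cheap, torus-homogeneous, window-dense, deep, spread
cofactors `NC_n^D`; deciding them needs a monotone lower bound for «a nest-free AND a noncrossing perfect
matching» (census item r4).  Nothing here bears on the truth of 21181; `NNDivisionHard`, `NNNotVP` and
`VP ≠ VNP` stay OPEN.  No definitions (the all-crossing matching is an explicit witness term), no named facts.
-/

noncomputable section

-- Sub = Summit single-conjunct layout: the duplicated namespace component is mandated by the tree.
set_option linter.dupNamespace false
set_option autoImplicit false

namespace Summit.ValiantsHypothesis.ValiantsHypothesis.Theorems.FifoMatching.NNDivisionHard.NoncrossingUndominated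

open MvPolynomial Finset Literature.Computability.AlgebraicComplexity
open scoped NNReal BigOperators Classical
open Summit.ValiantsHypothesis.ValiantsHypothesis.Theorems.FifoMatching.NNNotVP.DivisionSplit
  (σ NN SuppFn freeVars suppFn_iff_eval_ne_zero suppFn_freeVars_iff suppFn_NN_iff mem_support_arcExponent)
open Summit.ValiantsHypothesis.ValiantsHypothesis.Theorems.FifoMatching.NNDivisionHard.AvoidedMatching
  (undominated_iff_exists_avoided_nfpm)

variable {n : ℕ}

/-! ### §1 The all-crossing nest-free perfect matching -/

/-- **The all-crossing matching** `i ↦ i + n` (`i < n`), `i ↦ i − n` (`i ≥ n`) is a nest-free perfect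
matching of `[2n]` whose arcs pairwise cross: for openers `i < j`, `j < M i` (and then `M i < M j` by
nest-freeness). [folklore] -/
theorem exists_pairwiseCrossing_nfpm (n : ℕ) :
    ∃ M ∈ nestFreeMatchings (2 * n), ∀ i j : Fin (2 * n), i < M i → j < M j → i < j → j < M i := by
  let f : ℕ → ℕ := fun v => if v < n then v + n else v - n
  have hf : ∀ v, v < 2 * n → f v < 2 * n := by
    intro v hv
    simp only [f]
    split_ifs <;> omega
  have hfv : ∀ v, v < 2 * n → f (f v) = v := by
    intro v hv
    simp only [f]
    split_ifs <;> omega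
  have hfne : ∀ v, v < 2 * n → f v ≠ v := by
    intro v hv
    simp only [f]
    split_ifs <;> omega
  have hnest : ∀ a b, a < 2 * n → b < 2 * n → a < b → b < f b → f b < f a → False := by
    intro a b ha hb hab hb2 hba
    simp only [f] at hb2 hba
    split_ifs at hb2 hba <;> omega
  have hcross : ∀ a b, a < 2 * n → b < 2 * n → a < f a → b < f b → a < b → b < f a := by
    intro a b ha hb ha2 hb2 hab
    simp only [f] at ha2 hb2 ⊢
    split_ifs at ha2 hb2 ⊢ <;> omega
  refine ⟨fun i => ⟨f i.val, hf i.val i.isLt⟩, ?_, ?_⟩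
  · rw [mem_nestFreeMatchings, mem_perfectMatchings]
    refine ⟨⟨fun i => Fin.ext (hfv i.val i.isLt), fun i h => hfne i.val i.isLt (congrArg Fin.val h)⟩,
      fun i j hij hj hji => ?_⟩
    rw [Fin.lt_def] at hij hj hji
    exact hnest i.val j.val i.isLt j.isLt hij hj hji
  · intro i j hi hj hij
    rw [Fin.lt_def] at hi hj hij ⊢
    exact hcross i.val j.val i.isLt j.isLt hi hj hij

/-! ### §2 A noncrossing matching uses at most one arc of a pairwise-crossing matching -/

/-- **Counting lemma.**  If `N` is a noncrossing perfect matching of `[2n]`, `M` a nest-free perfect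
matching with pairwise crossing arcs, and every arc `(i, N i)`, `i < N i`, of `N` lies in `T` or is an arc
of `M`, then `n ≤ |T| + 1` (the arcs of `N` inside `M` pairwise cross, so there is at most one; the
others inject into `T`). [folklore] -/
theorem card_le_of_noncrossing_sub {N M : Fin (2 * n) → Fin (2 * n)}
    (hN : N ∈ noncrossingMatchings (2 * n)) (hM : M ∈ nestFreeMatchings (2 * n))
    (hcross : ∀ i j : Fin (2 * n), i < M i → j < M j → i < j → j < M i)
    (T : Finset (σ n)) (hsub : ∀ i : Fin (2 * n), i < N i → (i, N i) ∈ T ∨ N i = M i) :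
    n ≤ T.card + 1 := by
  obtain ⟨hNP, hNnc⟩ := mem_noncrossingMatchings.1 hN
  obtain ⟨hMP, hMnest⟩ := mem_nestFreeMatchings.1 hM
  obtain ⟨hMinv, -⟩ := mem_perfectMatchings.1 hMP
  -- openers of `N` split into `T`-arcs and `M`-arcs
  set O₁ : Finset (Fin (2 * n)) := (openers N).filter fun i => (i, N i) ∈ T with hO₁
  set O₂ : Finset (Fin (2 * n)) := (openers N).filter fun i => (i, N i) ∉ T with hO₂
  have hsplit : (openers N).card = O₁.card + O₂.card := by
    rw [hO₁, hO₂]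
    exact (Finset.card_filter_add_card_filter_not _).symm
  -- `|O₁| ≤ |T|`
  have h1 : O₁.card ≤ T.card := by
    refine Finset.card_le_card_of_injOn (fun i => (i, N i)) (fun i hi => ?_) ?_
    · rw [hO₁, Finset.mem_coe, Finset.mem_filter] at hi
      exact hi.2
    · intro i _ j _ hij
      exact (Prod.mk.inj hij).1
  -- `|O₂| ≤ 1`: two `M`-arcs of the noncrossing `N` would cross
  have h2 : O₂.card ≤ 1 := by
    rw [Finset.card_le_one]
    intro i hi j hj
    rw [hO₂, Finset.mem_filter, mem_openers] at hi hj
    have hiM : N i = M i := (hsub i hi.1).resolve_left hi.2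
    have hjM : N j = M j := (hsub j hj.1).resolve_left hj.2
    by_contra hne
    rcases lt_or_gt_of_ne hne with hlt | hgt
    · -- `i < j`: arcs `(i, M i)`, `(j, M j)` cross, contradicting noncrossing `N`
      have hiM' : i < M i := by rw [← hiM]; exact hi.1
      have hjM' : j < M j := by rw [← hjM]; exact hj.1
      have hc : j < M i := hcross i j hiM' hjM' hlt
      have hMiMj : M i < M j := by
        rcases lt_trichotomy (M i) (M j) with h | h | h
        · exact h
        · exact absurd ((Function.Involutive.injective hMinv) h) (ne_of_lt hlt)
        · exact absurd h (fun h' => hMnest i j hlt hjM' h')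
      exact hNnc i j hlt (by rw [hiM]; exact hc) (by rw [hiM, hjM]; exact hMiMj)
    · have hiM' : i < M i := by rw [← hiM]; exact hi.1
      have hjM' : j < M j := by rw [← hjM]; exact hj.1
      have hc : i < M j := hcross j i hjM' hiM' hgt
      have hMjMi : M j < M i := by
        rcases lt_trichotomy (M j) (M i) with h | h | h
        · exact h
        · exact absurd ((Function.Involutive.injective hMinv) h) (ne_of_lt hgt)
        · exact absurd h (fun h' => hMnest j i hgt hiM' h')
      exact hNnc j i hgt (by rw [hjM]; exact hc) (by rw [hjM, hiM]; exact hMjMi)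
  have hn : (openers N).card = n := card_openers hNP
  omega

/-! ### §3 The all-crossing matching is avoided by `NC_n` modulo small `T` -/

/-- **`NC_n` avoids the all-crossing matching modulo `T`** when `|T| + 2 ≤ n`:
`¬ SuppFn (NC_n|_{T:=1}) (arcs M)`. [folklore] -/
theorem exists_nfpm_avoided_by_noncrossing (T : Finset (σ n)) (hT : T.card + 2 ≤ n) :
    ∃ M ∈ nestFreeMatchings (2 * n),
      ¬ SuppFn (freeVars T (noncrossingMatchingPoly n ℝ≥0))
        (univ.filter fun e : σ n => e.1 < M e.1 ∧ M e.1 = e.2) := by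
  obtain ⟨M, hM, hcross⟩ := exists_pairwiseCrossing_nfpm n
  refine ⟨M, hM, fun hsupp => ?_⟩
  rw [suppFn_freeVars_iff] at hsupp
  obtain ⟨d, hd, hdsub⟩ := hsupp
  rw [support_noncrossingMatchingPoly, Finset.mem_image] at hd
  obtain ⟨N, hN, rfl⟩ := hd
  have hle := card_le_of_noncrossing_sub hN hM hcross T (fun i hi => ?_)
  · omega
  · have hmem : (i, N i) ∈ (arcExponent N).support := (mem_support_arcExponent N (i, N i)).2 ⟨hi, rfl⟩
    have h := hdsub hmem
    simp only [Finset.mem_union, Finset.mem_filter, Finset.mem_univ, true_and] at h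
    rcases h with hT' | ⟨_, h2⟩
    · exact Or.inl hT'
    · exact Or.inr h2.symm

/-! ### §4 The noncrossing powers are undominated -/

/-- **Cofactors whose shadow implies that of `NC_n` are undominated** modulo every `T` with
`|T| + 2 ≤ n`. [folklore] -/
theorem undominated_of_shadow_le_noncrossing {h : MvPolynomial (σ n) ℝ≥0}
    (hsub : ∀ B : Finset (σ n), SuppFn h B → SuppFn (noncrossingMatchingPoly n ℝ≥0) B)
    (T : Finset (σ n)) (hT : T.card + 2 ≤ n) :
    ∃ A : Finset (σ n), SuppFn (freeVars T (NN n)) A ∧ ¬ SuppFn (freeVars T h) A := by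
  rw [undominated_iff_exists_avoided_nfpm]
  obtain ⟨M, hM, hnot⟩ := exists_nfpm_avoided_by_noncrossing T hT
  refine ⟨M, hM, fun hh => hnot ?_⟩
  rw [suppFn_freeVars_iff] at hh ⊢
  exact hsub _ hh

/-- ★ **The noncrossing powers `NC_n^(D+1)` are UNDOMINATED** modulo every arc set `T` with
`|T| + 2 ≤ n` (in particular modulo every `T` of `≤ (log₂ n + k)^k` arcs, eventually in `n`):
`∃ A, SuppFn (NN_n|_{T:=1}) A ∧ ¬ SuppFn (NC_n^(D+1)|_{T:=1}) A`.  So the domination rungs never decide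
them. [folklore] -/
theorem noncrossingPow_undominated (D : ℕ) (T : Finset (σ n)) (hT : T.card + 2 ≤ n) :
    ∃ A : Finset (σ n), SuppFn (freeVars T (NN n)) A ∧
      ¬ SuppFn (freeVars T ((noncrossingMatchingPoly n ℝ≥0) ^ (D + 1))) A := by
  refine undominated_of_shadow_le_noncrossing (fun B hB => ?_) T hT
  rw [suppFn_iff_eval_ne_zero] at hB ⊢
  rw [map_pow] at hB
  exact fun h0 => hB (by rw [h0, zero_pow (Nat.succ_ne_zero D)])

end Summit.ValiantsHypothesis.ValiantsHypothesis.Theorems.FifoMatching.NNDivisionHard.NoncrossingUndominated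

end
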